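import Literature.AlgebraicGeometry.HodgeTheory.FermatHodgeCharacterCancel
import HarnessLib

/-!
# From the Hodge condition to character relations: glue lemmas (Aoki 1983, §9)

Support file XVI (everything PROVED; no named facts, no definitions) for the structure theorem of
the Hodge characters of the Fermat surface (`AokiShioda1983_thmB2m_standard`).

* `IsHodge.units_level_rel` : for a Hodge character all of whose coordinates are units, at every
  level `f ∣ m`: `∏_{p ∣ m} (1 - χ(p)⁻¹) · ∑ᵢ χ(αᵢ mod f) = 0` for every odd primitive `χ` mod `f`
  (Aoki's criterion [Aoki1983, Prop. 2.2] unpacked; the Euler factor is `∏_{p ∣ m, p ∤ f}`);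
  `IsHodge.units_top_rel` : at `f = m` simply `∑ χ(αᵢ) = 0`.
* `exists_odd_isPrimitive_apply_ne_one_of_sq_ne_one`, `natCast_sq_ne_one` : small integers are
  not in `U(f)` (since `U(f) ⊆ {w : w² = 1}` by [Aoki1983, Prop. 6.1]).
* arithmetic in `ℤ/m`: `half_mul_unit`, `two_mul_eq_zero_iff`.
[cite: Aoki1983, Props. 2.2, 6.1; §9]

## References

* [Aoki1983] N. Aoki, Math. Ann. 266 (1983) 23–54, §§2, 6, 9 (text read).
-/

noncomputable section

open Finset

namespace Literature.AlgebraicGeometry.HodgeTheory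

namespace FermatCharacter

section Glue

variable {m : ℕ}

/-- **The Hodge condition for a tuple of units, at the level `f ∣ m`.** For every odd primitive
character `χ` mod `f`: `∏_{p ∣ m} (1 - χ(p)⁻¹) · ∑ᵢ χ(αᵢ mod f) = 0` (the factors with `p ∣ f`
are `1`). [cite: Aoki1983, Prop. 2.2] -/
theorem IsHodge.units_level_rel [NeZero m] {r : ℕ} {α : Fin r → ZMod m} (h : IsHodge α)
    (hu : ∀ i, IsUnit (α i)) {f : ℕ} [NeZero f] (hfm : f ∣ m) (χ : DirichletCharacter ℂ f)
    (hχ : χ.Odd) (hprim : χ.IsPrimitive) :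
    (∏ p ∈ m.primeFactors, (1 - (χ p)⁻¹)) * ∑ i, χ (ZMod.castHom hfm (ZMod f) (α i)) = 0 := by
  classical
  have hm0 : m ≠ 0 := NeZero.ne m
  -- Aoki's criterion with `Mᵢ = m`, `wᵢ = αᵢ`
  have key := h.aoki_criterion hfm hχ hprim (fun _ ↦ m) (fun _ ↦ dvd_refl m) (fun i ↦ α i) hu
    (fun i ↦ by rw [Nat.div_self (Nat.pos_of_ne_zero hm0), Nat.cast_one, one_mul,
      ZMod.natCast_zmod_val])
  have hφ : ((m.totient : ℂ)) / (m.totient : ℂ) = 1 :=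
    div_self (by exact_mod_cast (Nat.totient_pos.mpr (Nat.pos_of_ne_zero hm0)).ne')
  simp only [if_pos hfm, hφ, one_mul, ← Finset.mul_sum] at key
  -- conjugate: `(χ x)⁻¹ = conj (χ x)` for every value of a Dirichlet character
  have hinv : ∀ x : ZMod f, (χ x)⁻¹ = starRingEnd ℂ (χ x) := by
    intro x
    by_cases hx : IsUnit x
    · exact Complex.inv_eq_conj (χ.unit_norm_eq_one hx.unit ▸ by rw [IsUnit.unit_spec])
    · rw [χ.map_nonunit hx, inv_zero, map_zero]
  have hcast : ∀ i, (ZMod.cast (α i) : ZMod f) = ZMod.castHom hfm (ZMod f) (α i) := fun i ↦ rfl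
  simp only [hcast] at key
  rcases mul_eq_zero.mp key with h0 | h0
  · rw [mul_eq_zero]; left
    have := congrArg (starRingEnd ℂ) h0
    rw [map_prod, map_zero] at this
    rw [← this]
    refine Finset.prod_congr rfl fun p _ ↦ ?_
    rw [map_sub, map_one, hinv]
  · rw [mul_eq_zero]; right
    have := congrArg (starRingEnd ℂ) h0
    rw [map_sum, map_zero] at this
    rw [← this]
    refine Finset.sum_congr rfl fun i _ ↦ ?_
    rw [hinv, starRingEnd_self_apply]

/-- **The Hodge condition for a tuple of units at the top level**: `∑ χ(αᵢ) = 0` for every odd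
primitive `χ` mod `m`. [cite: Aoki1983, Prop. 2.2, §9 (I)] -/
theorem IsHodge.units_top_rel [NeZero m] {r : ℕ} {α : Fin r → ZMod m} (h : IsHodge α)
    (hu : ∀ i, IsUnit (α i)) (χ : DirichletCharacter ℂ m) (hχ : χ.Odd) (hprim : χ.IsPrimitive) :
    ∑ i, χ (α i) = 0 := by
  classical
  have key := h.units_level_rel hu (dvd_refl m) χ hχ hprim
  have hone : (∏ p ∈ m.primeFactors, (1 - (χ p)⁻¹)) = 1 := by
    refine Finset.prod_eq_one fun p hp ↦ ?_
    have hpm : p ∣ m := Nat.dvd_of_mem_primeFactors hp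
    have hp1 : p.Prime := Nat.prime_of_mem_primeFactors hp
    have hnu : ¬ IsUnit ((p : ℕ) : ZMod m) := by
      rw [ZMod.isUnit_iff_coprime]
      intro hc
      have := Nat.Coprime.eq_one_of_dvd hc hpm
      exact hp1.one_lt.ne' this
    rw [χ.map_nonunit hnu, inv_zero, sub_zero]
  rw [hone, one_mul] at key
  simpa using key

/-- `U(f) ⊆ {w : w² = 1}` [Aoki1983, Prop. 6.1]: an element whose square is not `1` is detected by
some odd primitive character. [cite: Aoki1983, Prop. 6.1] -/
theorem exists_odd_isPrimitive_apply_ne_one_of_sq_ne_one {f : ℕ} [NeZero f]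
    (hval : Odd f ∨ 4 ∣ f) (h15 : f ≠ 15) (h20 : f ≠ 20) (w : (ZMod f)ˣ)
    (hw : (w : ZMod f) ^ 2 ≠ 1) :
    ∃ χ : DirichletCharacter ℂ f, χ.Odd ∧ χ.IsPrimitive ∧ χ w ≠ 1 := by
  by_contra hc
  push Not at hc
  exact hw (sq_eq_one_of_forall_odd_isPrimitive hval h15 h20 w fun χ h1 h2 ↦ hc χ h1 h2)

/-- For `1 < c` and `c² ≤ m`: `c² ≠ 1` in `ℤ/m`. [folklore] -/
theorem natCast_sq_ne_one {c : ℕ} (hc : 1 < c) (hcm : c ^ 2 ≤ m) : ((c : ZMod m)) ^ 2 ≠ 1 := by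
  intro h
  have h1 : ((c ^ 2 - 1 : ℕ) : ZMod m) = 0 := by
    rw [Nat.cast_sub (Nat.one_le_pow _ _ (by omega)), Nat.cast_pow, h, Nat.cast_one, sub_self]
  rw [ZMod.natCast_eq_zero_iff] at h1
  have hpos : 0 < c ^ 2 - 1 := by
    have : 1 < c ^ 2 := by nlinarith
    omega
  have := Nat.le_of_dvd hpos h1
  omega

/-- For `1 < c`, `c² ≤ m`: `(-c)² ≠ 1` in `ℤ/m` as well. [folklore] -/
theorem neg_natCast_sq_ne_one {c : ℕ} (hc : 1 < c) (hcm : c ^ 2 ≤ m) : (-(c : ZMod m)) ^ 2 ≠ 1 := by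
  rw [neg_sq]; exact natCast_sq_ne_one hc hcm

/-- In `ℤ/m` with `m` even: `(m/2) · c = m/2` for every unit `c`. [folklore] -/
theorem half_mul_unit [NeZero m] (h2 : 2 ∣ m) (c : (ZMod m)ˣ) :
    ((m / 2 : ℕ) : ZMod m) * (c : ZMod m) = ((m / 2 : ℕ) : ZMod m) := by
  have hodd : Odd (c : ZMod m).val := by
    have hcop := ZMod.val_coe_unit_coprime c
    rcases Nat.even_or_odd (c : ZMod m).val with he | ho
    · exfalso
      have h2' : 2 ∣ Nat.gcd (c : ZMod m).val m := Nat.dvd_gcd (even_iff_two_dvd.mp he) h2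
      rw [hcop] at h2'
      omega
    · exact ho
  obtain ⟨k, hk⟩ := hodd
  conv_lhs => rw [← ZMod.natCast_zmod_val (c : ZMod m), hk]
  push_cast
  have : ((m / 2 : ℕ) : ZMod m) * 2 = 0 := by
    rw [show (2 : ZMod m) = ((2 : ℕ) : ZMod m) by norm_cast, ← Nat.cast_mul,
      ZMod.natCast_eq_zero_iff, Nat.div_mul_cancel h2]
  linear_combination (k : ZMod m) * this

/-- In `ℤ/m` with `m` even: `2 x = 0 ↔ x = 0 ∨ x = m/2`. [folklore] -/
theorem two_mul_eq_zero_iff [NeZero m] (h2 : 2 ∣ m) (x : ZMod m) :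
    2 * x = 0 ↔ x = 0 ∨ x = ((m / 2 : ℕ) : ZMod m) := by
  have hm0 : m ≠ 0 := NeZero.ne m
  constructor
  · intro h
    have h1 : ((2 * x.val : ℕ) : ZMod m) = 0 := by push_cast; rw [ZMod.natCast_zmod_val]; exact h
    rw [ZMod.natCast_eq_zero_iff] at h1
    obtain ⟨k, hk⟩ := h1
    have hx : x.val < m := ZMod.val_lt x
    have hk2 : k < 2 := by
      by_contra hk2; push Not at hk2
      have : m * 2 ≤ m * k := Nat.mul_le_mul_left m hk2
      omega
    interval_cases k
    · left
      have : x.val = 0 := by omega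
      rw [← ZMod.natCast_zmod_val x, this, Nat.cast_zero]
    · right
      have : x.val = m / 2 := by omega
      rw [← ZMod.natCast_zmod_val x, this]
  · rintro (rfl | rfl)
    · rw [mul_zero]
    · rw [show (2 : ZMod m) = ((2 : ℕ) : ZMod m) by norm_cast, ← Nat.cast_mul,
        ZMod.natCast_eq_zero_iff, Nat.mul_div_cancel' h2]

/-- A residue that vanishes mod a divisor `d > 1` of `m` is not a unit mod `m`. [folklore] -/
theorem not_isUnit_of_castHom_eq_zero [NeZero m] {d : ℕ} (hd : d ∣ m) (hd1 : 1 < d) (x : ZMod m)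
    (h : ZMod.castHom hd (ZMod d) x = 0) : ¬ IsUnit x := by
  intro hu
  have hcop := ZMod.val_coe_unit_coprime hu.unit
  rw [IsUnit.unit_spec] at hcop
  have hdx : d ∣ x.val := by
    rw [← ZMod.natCast_zmod_val x, map_natCast, ZMod.natCast_eq_zero_iff] at h
    exact h
  have := Nat.dvd_gcd hdx hd
  rw [hcop] at this
  exact absurd (Nat.le_of_dvd one_pos this) (by omega)

end Glue

end FermatCharacter

end Literature.AlgebraicGeometry.HodgeTheory
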